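import Summits.ABC.ABC.Theses.DefiniteXi
import Summits.ABC.ABC.Theorems.DefiniteXiDefiniteRTControlPrime
import Summits.ABC.ABC.Theorems.DefiniteXiFreyModularity
import Summits.ABC.ABC.Theorems.DefiniteXiDefiniteRTControlPrimeSmulTransportDeg
import Summits.ABC.ABC.Theorems.DefiniteXiDefiniteRTControlPrimeValTransport
import Summits.ABC.ABC.Theorems.DefiniteXiDefiniteRTControlPrimeFreyScale
import Summits.ABC.ABC.Theorems.DefiniteXiDefiniteRTControlPrimeFreyLocal
import Summits.ABC.ABC.Theorems.IsogenyGlueCongruenceMazurKenkuBoundOfRadius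
import Summits.ABC.ABC.Theorems.DefiniteXiDefiniteRTControlPrimeCyclicDegreeFrobNorm
import HarnessLib

/-!
# Crux `DefiniteRTControlPrime` from Takahashi 2.3 alone — part 5/7: the radius leaves and the one-isogeny plumbing

The typed leaves `FreyIsogenyRadius R`, `FreyIsogenyRadiusSubpoly` (rooted radius `≤ R_ε N^ε` of the Frey
isogeny class at an odd conductor prime) and `FreyOptimalRadiusSubpoly` (one isogeny to the Takahashi pivot);
plumbing: degrees of composites/duals, kernels of `z ↦ cz`, pushing a modular parametrisation datum along ONE
isogeny with its degree (`modularDegree_le_degree_mul`), the Mazur-free valuation leg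
`ordMinimalDiscriminant_le_degree_mul` / `factorization_le_mul_of_isogeny`, and the suppliers
`freyIsogenyRadius_of_mazurKenkuRadius`, `freyIsogenyRadiusSubpoly_of_radius`, `freyOptimalRadiusSubpoly_of_rooted`.
(Verbatim the k2-g5 companion; independent of parts 1–4.)

Origin: crux programme of stmt-ABC-11338, kernel certificate `Cruxes/DefiniteRTControlPrime/StubIdeasK2G11CruxFromTakahashi.lean` (stub-ideation k2, gens 2–11; farm `lean check` rc 0, 0 sorries, axioms propext/Classical.choice/Quot.sound), re-packaged verbatim into seven `≤ 400`-line modules by k2 gen 12 (namespaces `…Theorems.DefiniteRTControlPrime.CyclicCharacter` / `.OfTakahashi`; statements and proofs unchanged).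

## References

* [Mazur1978] B. Mazur, Rational isogenies of prime degree, Invent. Math. 44 (1978) 129–162, §5 (isogeny characters), Lemma 5.2–5.4.
* [Serre1972] J.-P. Serre, Propriétés galoisiennes des points d'ordre fini des courbes elliptiques, Invent. Math. 15 (1972), §1.11–1.12, §5.4 Prop. 21.
* [SilvermanATAEC1994] J. H. Silverman, Advanced Topics in the Arithmetic of Elliptic Curves, GTM 151, Thm. V.5.3, Cor. V.5.4, Prop. V.6.1 (Tate curve, Galois action).
* [Takahashi2001] S. Takahashi, Degrees of parametrizations of elliptic curves by Shimura curves, J. Number Theory 90 (2001) 74–88, Thm. 2.3 (p. 79).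
* [PastenShimura2024] H. Pasten, Shimura curves and the abc conjecture, J. Number Theory 254 (2024) 214–335 = arXiv:1705.09251, §3 p. 13, §6.4, Lemma 6.8.
-/

set_option linter.dupNamespace false

noncomputable section

open scoped Classical MatrixGroups ModularForm
open CongruenceSubgroup UpperHalfPlane
open WeierstrassCurve IsDedekindDomain NumberField
open Literature.NumberTheory.EllipticCurves Literature.NumberTheory.EllipticCurves.ModularForms
open Literature.NumberTheory.DiophantineGeometry
open Literature.NumberTheory.Automorphic
open Summit.ABC.ABC.Theorems
open Summit.ABC.ABC.Theses.DefiniteXi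

namespace Summit.ABC.ABC.Theorems.DefiniteRTControlPrime.OfTakahashi

/-! ## 0. The leaves -/

/-- **L1.** Rooted radius of the Frey isogeny class at an odd conductor prime (verbatim the k2-g2…g4
`FreyIsogenyRadius`): every curve `ℚ`-isogenous to `E_(a,b)` is reached from it by a `ℚ`-isogeny of
degree `≤ R`. -/
def FreyIsogenyRadius (R : ℕ) : Prop :=
  ∀ (a b : ℤ), IsCoprime a b → a * b * (a + b) ≠ 0 → ∀ q : ℕ, q.Prime → q ≠ 2 →
    q ∣ (freyCurve a b).conductorNorm ℤ →
    ∀ (W' : WeierstrassCurve ℚ) [W'.IsElliptic], (freyCurve a b).IsIsogenous W' →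
      ∃ φ : Isogeny (freyCurve a b) W', φ.degree ≤ R

/-- **L1ε.** Sub-polynomial rooted radius: for every `ε > 0`, radius `≤ R_ε · N^ε` (`N` the conductor). -/
def FreyIsogenyRadiusSubpoly : Prop :=
  ∀ ε : ℝ, 0 < ε → ∃ R : ℝ, ∀ (a b : ℤ), IsCoprime a b → a * b * (a + b) ≠ 0 →
    ∀ q : ℕ, q.Prime → q ≠ 2 → q ∣ (freyCurve a b).conductorNorm ℤ →
    ∀ (W' : WeierstrassCurve ℚ) [W'.IsElliptic], (freyCurve a b).IsIsogenous W' →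
      ∃ φ : Isogeny (freyCurve a b) W',
        (φ.degree : ℝ) ≤ R * (((freyCurve a b).conductorNorm ℤ : ℕ) : ℝ) ^ ε

/-- **L0 — THE WEAKEST LEAF (one isogeny).** For every `ε > 0` there is `R` such that the Frey curve
of conductor `N` is joined to any `X₀(N)`-OPTIMAL curve `W⋆` of its class — a conductor-`N` curve
carrying a datum `P⋆` of minimal degree among all level-`N` data of conductor-`N` curves with the same
newform, verbatim Takahashi's minimality clause — by a `ℚ`-isogeny of degree `≤ R · N^ε`. -/
def FreyOptimalRadiusSubpoly : Prop :=
  ∀ ε : ℝ, 0 < ε → ∃ R : ℝ, ∀ (a b : ℤ), IsCoprime a b → a * b * (a + b) ≠ 0 →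
    ∀ (N : ℕ) [NeZero N], (freyCurve a b).conductorNorm ℤ = N →
    ∀ q : ℕ, q.Prime → q ≠ 2 → q ∣ N →
    ∀ (W' : WeierstrassCurve ℚ) [W'.IsElliptic] (P' : ModularParametrizationData W' N),
      W'.conductorNorm ℤ = N →
      (∀ (W'' : WeierstrassCurve ℚ) [W''.IsElliptic], W''.conductorNorm ℤ = N →
          ∀ P'' : ModularParametrizationData W'' N, P''.f = P'.f →
            P'.modularDegree ≤ P''.modularDegree) →
      (freyCurve a b).IsIsogenous W' →
        ∃ φ : Isogeny (freyCurve a b) W', (φ.degree : ℝ) ≤ R * (N : ℝ) ^ ε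

/-! ## 1. Plumbing: degrees of composites and duals, kernels of `z ↦ cz` multiply -/

/-- R0a (k2-g4, PROVED): degree of a composite. [folklore] -/
theorem degree_comp {W W' W'' : WeierstrassCurve ℚ} [W.IsElliptic] [W'.IsElliptic]
    (ψ : Isogeny W' W'') (φ : Isogeny W W') : (ψ.comp φ).degree = ψ.degree * φ.degree := by
  change Nat.card (ψ.toAddMonoidHom.comp φ.toAddMonoidHom).ker = _
  rw [AddMonoidHom.natCard_ker_comp_of_surjective _ _ φ.surjective]
  rfl

/-- R0c: the dual isogeny has the same degree. [cite: SilvermanAEC2009, Thm. III.6.1(a), III.6.2(e)] -/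
theorem exists_dual_degree_eq {W W' : WeierstrassCurve ℚ} [W.IsElliptic] [W'.IsElliptic]
    (φ : Isogeny W W') : ∃ ψ : Isogeny W' W, ψ.degree = φ.degree := by
  obtain ⟨ψ, hψ⟩ := φ.exists_dual_of_isElliptic
  exact ⟨ψ, Isogeny_degree_eq_of_comp_eq_degree_zsmul φ ψ hψ⟩

/-- **P1a.** Kernels multiply along `ℂ/Λ₁ →(c) ℂ/Λ₂ →(d) ℂ/Λ₃`:
`#ker(z ↦ dcz) = #ker(z ↦ dz) · #ker(z ↦ cz)` (`c ≠ 0`, so the first map is onto). [folklore] -/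
theorem natCard_ker_mulQuotientMap_mul {Λ₁ Λ₂ Λ₃ : AddSubgroup ℂ} {c d : ℂ} (hc0 : c ≠ 0)
    (hc : ∀ z ∈ Λ₁, c * z ∈ Λ₂) (hd : ∀ z ∈ Λ₂, d * z ∈ Λ₃)
    (hdc : ∀ z ∈ Λ₁, d * c * z ∈ Λ₃) :
    Nat.card (mulQuotientMap Λ₁ Λ₃ (d * c) hdc).ker =
      Nat.card (mulQuotientMap Λ₂ Λ₃ d hd).ker * Nat.card (mulQuotientMap Λ₁ Λ₂ c hc).ker := by
  have hcomp : (mulQuotientMap Λ₂ Λ₃ d hd).comp (mulQuotientMap Λ₁ Λ₂ c hc) =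
      mulQuotientMap Λ₁ Λ₃ (d * c) hdc := by
    refine AddMonoidHom.ext fun P => ?_
    induction P using QuotientAddGroup.induction_on with
    | H z =>
      rw [AddMonoidHom.comp_apply, mulQuotientMap_mk, mulQuotientMap_mk, mulQuotientMap_mk,
        mul_assoc]
  rw [← hcomp, AddMonoidHom.natCard_ker_comp_of_surjective _ _ (mulQuotientMap_surjective hc0)]

/-- Transport of `#ker(z ↦ cz)` along equalities of the lattices AND of the multiplier. [folklore] -/
theorem natCard_ker_mulQuotientMap_congr' {Λ₁ Λ₁' Λ₂ Λ₂' : AddSubgroup ℂ} (h₁ : Λ₁ = Λ₁')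
    (h₂ : Λ₂ = Λ₂') {c c' : ℂ} (hcc : c = c') (hc : ∀ z ∈ Λ₁, c * z ∈ Λ₂)
    (hc' : ∀ z ∈ Λ₁', c' * z ∈ Λ₂') :
    Nat.card (mulQuotientMap Λ₁ Λ₂ c hc).ker = Nat.card (mulQuotientMap Λ₁' Λ₂' c' hc').ker := by
  subst h₁ h₂ hcc
  rfl

/-! ## 2. P1 — push a datum forward along ONE isogeny, keeping track of the degree -/

/-- **P1 (the gen-5 helper).**  Let `(V, P)` and `(W', D')` be parametrised at level `N` with the same
newform, `W'` globally minimal and `D'` of minimal degree among the data of `W'`; let `ψ` be a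
`ℚ`-isogeny from a model of `V` onto a model of `W'` whose base changes are the lattice curves of the
two period pairs (the short models, `shortModel_baseChange_eq_curve`).  Then `deg D' ≤ deg ψ · deg P`:
the parametrisation `ψ ∘ φ_P` of `W'` has Manin multiplier `k = q · c_P` (`q` the rational multiplier
of `ψ`), integral by Edixhoven's integrality in the tree's form `hInt_of_pivot`, and degree
`#ker(z ↦ kz) · δ = #ker(q) · #ker(c_P) · δ = deg ψ · deg P`.  (Folklore: `deg φ_{E'} ∣ deg ψ · deg φ_E`
for `ψ : E → E'`; Cremona, *Algorithms* §2.10.)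
[cite: SilvermanAEC2009, Thm. VI.4.1(b)] [cite: EdixhovenManin1991, Prop. 2] -/
theorem modularDegree_le_degree_mul {N : ℕ} [NeZero N] {V W' : WeierstrassCurve ℚ}
    [V.IsElliptic] [W'.IsElliptic] [W'.IsGloballyMinimal]
    (P : ModularParametrizationData V N) (D' : ModularParametrizationData W' N) (hf : D'.f = P.f)
    (hmin' : ∀ D'' : ModularParametrizationData W' N, D'.modularDegree ≤ D''.modularDegree)
    {Vs Ws : WeierstrassCurve ℚ} [Vs.IsElliptic] [Ws.IsElliptic] (ψ : Isogeny Vs Ws)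
    (hVs : Vs.baseChange ℂ = P.L.curve) (hWs : Ws.baseChange ℂ = D'.L.curve) :
    D'.modularDegree ≤ ψ.degree * P.modularDegree := by
  have hInt : ∀ {N : ℕ} [NeZero N] {W' : WeierstrassCurve ℚ} [W'.IsElliptic] [W'.IsGloballyMinimal]
      (D' : ModularParametrizationData W' N) (q : ℚ),
      (∀ z ∈ periodLattice D'.f, (q : ℂ) * z ∈ D'.L.lattice) → ∃ k : ℤ, (k : ℚ) = q :=
    hInt_of_pivot integral_neronScaling_of_isGloballyMinimal_holds edixhovenIntegrality_proof
  -- the rational multiplier `q` of `ψ`, `#ker(z ↦ qz : ℂ/Λ_V → ℂ/Λ_{W'}) = deg ψ`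
  obtain ⟨q, hq0, hq, hdegq⟩ :=
    degree_eq_natCard_ker_mulQuotientMap_of_baseChange_eq_curve ψ hVs hWs
  -- `k := q · c_P`, `k Λ_f ⊆ Λ_{W'}`, `k ∈ ℤ`
  have hPc : ∀ z ∈ periodLattice D'.f, (P.c : ℂ) * z ∈ P.L.lattice := fun z hz ↦
    P.smul_periodLattice_le z (hf ▸ hz)
  have hk' : ∀ z ∈ periodLattice D'.f, ((q * P.c : ℚ) : ℂ) * z ∈ D'.L.lattice := fun z hz ↦ by
    have h := hq _ (hPc z hz)
    rw [← mul_assoc] at h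
    push_cast
    exact h
  obtain ⟨k, hkq⟩ := hInt D' (q * P.c) hk'
  have hkC : (k : ℂ) = (q : ℂ) * (P.c : ℂ) := by
    have h := congrArg (fun x : ℚ => (x : ℂ)) hkq
    push_cast at h
    exact h
  have hk : ∀ z ∈ periodLattice D'.f, (k : ℂ) * z ∈ D'.L.lattice := fun z hz ↦ by
    have h := hk' z hz
    push_cast at h
    rwa [hkC]
  have hc : (P.c : ℚ) ≠ 0 := by exact_mod_cast P.maninConstant_ne_zero_holds
  have hk0 : k ≠ 0 := by
    have h : (k : ℚ) ≠ 0 := by rw [hkq]; exact mul_ne_zero hq0 hc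
    exact_mod_cast h
  -- the common degree `δ` of the Eichler–Shimura map of `f`
  haveI := discreteTopology_periodLattice_of_mul_mem D'.f D'.cast_c_ne_zero D'.smul_periodLattice_le
  obtain ⟨δ, hδ, hfinδ⟩ := exists_degree_eichlerShimuraMap' (N := N) D'.isNewformOf.1.ne_zero
  -- the datum of `W'` with Manin constant `k`, and the two degree formulas
  obtain ⟨Dk, hDkf, hDkL, -, hDkc⟩ := D'.exists_datum_c_eq hk0 hk
  obtain ⟨-, hdegK⟩ := Dk.modularDegree_eq_card_ker_mul_of_eichlerShimuraMap hDkf hδ hfinδ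
  obtain ⟨-, hdegP⟩ := P.modularDegree_eq_card_ker_mul_of_eichlerShimuraMap hf.symm hδ hfinδ
  -- `#ker(k) = #ker(q) · #ker(c_P) = deg ψ · #ker(c_P)`
  have hqc : ∀ z ∈ (periodLattice P.f : AddSubgroup ℂ), (q : ℂ) * (P.c : ℂ) * z ∈
      D'.L.lattice.toAddSubgroup := fun z hz ↦ by
    rw [mul_assoc]
    exact hq _ (P.smul_periodLattice_le z hz)
  have hmul : Nat.card Dk.isogenyMap.ker = ψ.degree * Nat.card P.isogenyMap.ker := by
    have h1 : Nat.card Dk.isogenyMap.ker =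
        Nat.card (mulQuotientMap (periodLattice P.f) D'.L.lattice.toAddSubgroup
          ((q : ℂ) * (P.c : ℂ)) hqc).ker :=
      natCard_ker_mulQuotientMap_congr' (by rw [hDkf, hf]) (by rw [hDkL]) (by rw [hDkc, hkC]) _ _
    have hq'' : ∀ z ∈ P.L.lattice.toAddSubgroup, (q : ℂ) * z ∈ D'.L.lattice.toAddSubgroup :=
      fun z hz => hq z hz
    rw [h1, natCard_ker_mulQuotientMap_mul (Λ₂ := P.L.lattice.toAddSubgroup) P.cast_c_ne_zero
      P.smul_periodLattice_le hq'' hqc, ← hdegq]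
    rfl
  calc D'.modularDegree ≤ Dk.modularDegree := hmin' Dk
    _ = Nat.card Dk.isogenyMap.ker * δ := hdegK
    _ = ψ.degree * (Nat.card P.isogenyMap.ker * δ) := by rw [hmul, mul_assoc]
    _ = ψ.degree * P.modularDegree := by rw [← hdegP]

/-! ## 3. H2 — the valuation leg from ONE isogeny (k2-g4 H2a/H2, PROVED, Mazur-free) -/

/-- **H2a**: along a `ℚ`-isogeny of degree `d`, `c_v` moves by a factor `≤ d` at a multiplicative
place. [cite: PastenShimura2024, §6.4 (p. 22)] -/
theorem ordMinimalDiscriminant_le_degree_mul {W W' : WeierstrassCurve ℚ} [W.IsElliptic]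
    [W'.IsElliptic] (ψ : Isogeny W W') (v : HeightOneSpectrum ℤ)
    (hv : W.HasMultiplicativeReductionAt v) :
    W'.ordMinimalDiscriminant v ≤ ψ.degree * W.ordMinimalDiscriminant v := by
  obtain ⟨ψ', hcyc, hdvd⟩ := ψ.exists_isCyclic_degree_dvd
  have hv' : W'.HasMultiplicativeReductionAt v :=
    hasMultiplicativeReductionAt_of_isIsogenous ⟨ψ⟩ v hv
  obtain ⟨m, n, hm, hn, hmn, heq⟩ :=
    exists_ordMinimalDiscriminant_mul_eq_mul_of_isCyclic ψ'.degree ψ' hcyc rfl v hv hv'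
  have hle : m * n ≤ ψ.degree :=
    (Nat.le_of_dvd ψ'.degree_pos hmn).trans (Nat.le_of_dvd ψ.degree_pos hdvd)
  have hn' : n ≤ ψ.degree := (Nat.le_mul_of_pos_left n hm).trans hle
  calc W'.ordMinimalDiscriminant v
      ≤ W'.ordMinimalDiscriminant v * m := Nat.le_mul_of_pos_right _ hm
    _ = W.ordMinimalDiscriminant v * n := heq.symm
    _ ≤ W.ordMinimalDiscriminant v * ψ.degree := Nat.mul_le_mul_left _ hn'
    _ = ψ.degree * W.ordMinimalDiscriminant v := Nat.mul_comm _ _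

/-- **H2**: `v_q(Δ_min W') ≤ d · v_q(Δ_min E_(a,b))` from ONE `ℚ`-isogeny `E_(a,b) → W'` of degree
`≤ d`, `q` an odd conductor prime. -/
theorem factorization_le_mul_of_isogeny {a b : ℤ} (hab : IsCoprime a b) (h0 : a * b * (a + b) ≠ 0)
    {q : ℕ} (hq : q.Prime) (hq2 : q ≠ 2) (hqN : q ∣ (freyCurve a b).conductorNorm ℤ)
    {W' : WeierstrassCurve ℚ} [W'.IsElliptic] {B : ℕ} (φ : Isogeny (freyCurve a b) W')
    (hφ : φ.degree ≤ B) :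
    (W'.minimalDiscriminantNorm ℤ).factorization q ≤
      B * ((freyCurve a b).minimalDiscriminantNorm ℤ).factorization q := by
  haveI := isElliptic_freyCurve h0
  obtain ⟨v, hv⟩ :
      ∃ v : HeightOneSpectrum ℤ, Rat.HeightOneSpectrum.natGenerator v = q :=
    ⟨(Rat.HeightOneSpectrum.primesEquiv (R := ℤ)).symm ⟨q, hq⟩,
      Rat.natGenerator_primesEquiv_symm ⟨q, hq⟩⟩
  have hdvd : (q : ℤ) ∣ a * b * (a + b) := dvd_of_dvd_conductorNorm_freyCurve hab h0 hq hq2 hqN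
  have hmult : (freyCurve a b).HasMultiplicativeReductionAt v :=
    hasMultiplicativeReductionAt_freyCurve_of_ne_two hab h0 v (hv ▸ hq2) (hv ▸ hdvd)
  have h1 := factorization_minimalDiscriminantNorm_holds (freyCurve a b) v
  have h2 := factorization_minimalDiscriminantNorm_holds W' v
  rw [hv] at h1 h2
  rw [h1, h2]
  exact (ordMinimalDiscriminant_le_degree_mul φ v hmult).trans (Nat.mul_le_mul_right _ hφ)

/-! ## 4. Suppliers of the leaves -/

/-- The route item `MazurKenkuRadius` (stmt-ABC-15193) ⟹ L1 with `R = 163`. -/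
theorem freyIsogenyRadius_of_mazurKenkuRadius (h : MazurKenkuRadius) : FreyIsogenyRadius 163 := by
  intro a b hab h0 q hq hq2 hqN W' _ hiso
  haveI := isElliptic_freyCurve h0
  exact h (freyCurve a b) W' hiso

/-- L1 ⟹ L1ε (the `N^ε` is idle: `N ≥ 1`). -/
theorem freyIsogenyRadiusSubpoly_of_radius {R : ℕ} (hR : FreyIsogenyRadius R) :
    FreyIsogenyRadiusSubpoly := by
  intro ε hε
  refine ⟨R, fun a b hab h0 q hq hq2 hqN W' _ hiso => ?_⟩
  obtain ⟨φ, hφ⟩ := hR a b hab h0 q hq hq2 hqN W' hiso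
  haveI := isElliptic_freyCurve h0
  refine ⟨φ, ?_⟩
  have hN1 : (1 : ℝ) ≤ (((freyCurve a b).conductorNorm ℤ : ℕ) : ℝ) := by
    exact_mod_cast (freyCurve a b).conductorNorm_pos_holds
  have hrpow : (1 : ℝ) ≤ (((freyCurve a b).conductorNorm ℤ : ℕ) : ℝ) ^ ε :=
    Real.one_le_rpow hN1 hε.le
  have hR0 : (0 : ℝ) ≤ (R : ℝ) := Nat.cast_nonneg R
  calc (φ.degree : ℝ) ≤ (R : ℝ) := by exact_mod_cast hφ
    _ = (R : ℝ) * 1 := (mul_one _).symm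
    _ ≤ (R : ℝ) * (((freyCurve a b).conductorNorm ℤ : ℕ) : ℝ) ^ ε :=
        mul_le_mul_of_nonneg_left hrpow hR0

/-- L1ε ⟹ L0 (forget that `W⋆` is optimal). -/
theorem freyOptimalRadiusSubpoly_of_rooted (hR : FreyIsogenyRadiusSubpoly) :
    FreyOptimalRadiusSubpoly := by
  intro ε hε
  obtain ⟨R, hR⟩ := hR ε hε
  refine ⟨R, fun a b hab h0 N _ hN q hq hq2 hqN W' _ P' _ _ hiso => ?_⟩
  have hqN' : q ∣ (freyCurve a b).conductorNorm ℤ := by rw [hN]; exact hqN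
  obtain ⟨φ, hφ⟩ := hR a b hab h0 q hq hq2 hqN' W' hiso
  refine ⟨φ, ?_⟩
  rwa [hN] at hφ

end Summit.ABC.ABC.Theorems.DefiniteRTControlPrime.OfTakahashi

end
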